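import Mathlib
import HarnessLib
import Summits.ValiantsHypothesis.ValiantsHypothesis.Theses.MonotoneRestoration
import Literature.Computability.AlgebraicComplexity.ArithCircuit
import Literature.Computability.AlgebraicComplexity.ArithCircuitProofs
import Literature.Computability.AlgebraicComplexity.MonotoneStructure
import Literature.Computability.AlgebraicComplexity.PermanentIrreducible
import Literature.ModelTheory.FiniteModelTheory.CkEquiv
import Summits.ValiantsHypothesis.ValiantsHypothesis.Theorems.MonotoneRestorationMonotoneRestorationQPCosetCount
import Summits.ValiantsHypothesis.ValiantsHypothesis.Theorems.MonotoneRestorationMonotoneRestorationQPSymmetricLB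
import Summits.ValiantsHypothesis.ValiantsHypothesis.Theorems.MonotoneRestorationMonotoneRestorationQPSupportSymmetrisation
import Summits.ValiantsHypothesis.ValiantsHypothesis.Theorems.MonotoneRestorationMonotoneRestorationQPSparseRegime
import Summits.ValiantsHypothesis.ValiantsHypothesis.Theorems.MonotoneRestorationMonotoneRestorationQPBeta
import Literature.Computability.AlgebraicComplexity.SymmetricArithCircuit
import Literature.Computability.AlgebraicComplexity.DawarWilsenach2025Proofs
import Literature.GroupTheory.PermutationGroups.SmallIndexSubgroups
import Summits.ValiantsHypothesis.ValiantsHypothesis.Theorems.MonotoneRestorationQP.Negative.LoadBearing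
import Summits.ValiantsHypothesis.ValiantsHypothesis.Theorems.MonotoneRestorationMonotoneRestorationQPPermSupportCount

/-! TTRL-lite variant V20073 of stmt-ValiantsHypothesis-15886

(`stub_symmetricMonotone_choose_le_card` of crux `MonotoneRestorationQP`, move `lemma_proposal`,
have-step `gamma_degree_eq_card_rows`): a row-multilinear monomial `m` in the doubly indexed
variables `x_{i,j}` (every row degree `rowDegrees m i ≤ 1`) involves exactly `deg m` rows, i.e.
`deg m = |supp (rowDegrees m)|`.  Proof: the row degrees sum to the degree (`degree_rowDegrees`),
and a `{0,1}`-valued finitely supported function has as many support points as its total mass.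
No new definitions, no named facts. -/

-- `Summit.ValiantsHypothesis.ValiantsHypothesis.…` is the tree's mandated single-conjunct layout
-- (Sub = Summit), so the duplicated namespace component is intended.
set_option linter.dupNamespace false

namespace Summit.ValiantsHypothesis.ValiantsHypothesis.Theorems

open Summit.ValiantsHypothesis.ValiantsHypothesis.Theses.MonotoneRestoration
open Literature.Computability.AlgebraicComplexity

/-- TTRL-lite variant V20073 of `stub_symmetricMonotone_choose_le_card`
(stmt-ValiantsHypothesis-15886), **degree = number of rows for row-multilinear monomials**: if every
row degree of the monomial `m : Fin n × Fin n →₀ ℕ` is `≤ 1`, then `deg m = |supp (rowDegrees m)|`.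
The row degrees sum to the degree (`degree_rowDegrees`) and each nonzero one equals `1`.
[folklore] -/
theorem stub_symmetricMonotone_choose_le_card_var20073 :
    ∀ (n : ℕ) (m : Fin n × Fin n →₀ ℕ), (∀ i : Fin n, rowDegrees m i ≤ 1) →
      m.degree = (rowDegrees m).support.card := by
  classical
  intro n m h1
  rw [← degree_rowDegrees, Finsupp.degree_apply, Finset.card_eq_sum_ones]
  refine Finset.sum_congr rfl fun i hi => ?_
  have h2 := Finsupp.mem_support_iff.1 hi
  have h3 := h1 i
  omega

end Summit.ValiantsHypothesis.ValiantsHypothesis.Theorems
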